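import Literature.MathematicalPhysics.QuantumFieldTheory.QCDTransferMatrix
import Literature.MathematicalPhysics.QuantumLattice.GaugeGroups

/-!
# Dictionary: the kinetic remainder of the Wilson slice block is Smit's `½∑ⱼ (W_j − W_jᴴ) ⊗ γⱼ`
(crux `QuarksAsStableAction.StableActionBridge`, item stmt-QuantumFields-9737, line `Sketch`;
registered stub `timeSlice_kinetic_dictionary` of the lead skeleton)

The Wilson-determinant transfer form (`wilson_det_transfer_form`) reads the slice-`t` part of the
tree's `r = 1` Wilson–Dirac operator `wilsonDirac (fundamentalRep (Fin 3)) U m 1` of a four-torus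
`SU(3)` gauge field `U` on the index `TorusSite 3 L × Fin 3 × Fin 4` (site `x`, colour `c`,
spin `α`) as the explicit matrix

  `A_{(x,c,α),(y,d,β)} = δ (m + 4) − ½ ∑ⱼ ( δ_{y,x+ĵ} (1 − γ_{j+1})_{αβ} ρ(U((t,x), j+1))_{cd}
      + δ_{x,y+ĵ} (1 + γ_{j+1})_{αβ} ρ(U((t,y), j+1))⁻¹_{cd} )`,

`ρ = fundamentalRep (Fin 3)` (Euclidean time is coordinate `0`, so the spatial direction `j : Fin 3`
of the three-torus is the four-torus direction `j.succ`), together with the spin-diagonal lift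
`B̂_{(x,c,α),(y,d,β)} = δ_{αβ} B_{(x,c),(y,d)}` of its spin-blind block
`B = δ (m + 4) − ½ ∑ⱼ (δ_{y,x+ĵ} ρ(U)_{cd} + δ_{x,y+ĵ} ρ(U)⁻¹_{cd})` (Smit's `A(U) ⊗ 1₄`,
*Introduction to Quantum Fields on a Lattice* §6.5 (6.74)).

`timeSlice_kinetic_dictionary`: the kinetic remainder `A − B̂` is, entry by entry (one flavour,
flavour index `0 : Fin 1`), Smit's `½ ∑ⱼ (W_j − W_jᴴ) ⊗ γ_{j+1}` in the vocabulary of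
`QCDTransferMatrix.lean` — `sliceKron (colourHop V j − (colourHop V j)ᴴ) (euclideanGamma j.succ)`
for the slice configuration `V : e ↦ U((t, e.1), e.2.succ)` (§6.5 (6.75): the `γⱼ`-part of the
spatial Wilson term, `ψ̄ ½∑ⱼ γⱼ (W_j − W_jᴴ) ψ`).  The mass terms and the spin-diagonal
`−½ (W_j + W_jᴴ) ⊗ 1₄` parts of `A` cancel against `B̂`; what is left is
`+½ δ_{y,x+ĵ} (γ_{j+1})_{αβ} U_{cd} − ½ δ_{x,y+ĵ} (γ_{j+1})_{αβ} (U⁻¹)_{cd}`, and the backward hop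
matches the conjugate-transpose entry `((colourHop V j)ᴴ)_{(x,c),(y,d)} = star (U((t,y), j+1)_{dc})`
because `U⁻¹ = Uᴴ` in `SU(3)` (Mathlib's `Matrix.star_eq_inv`, definitional).  The proof is this
bookkeeping: unfold to entries, split on the spin delta `δ_{αβ}` and on the two shift conditions,
and close each case by `ring`.

[cite: Smit2023, §6.5 (6.74)–(6.75)]
-/

noncomputable section

open MeasureTheory Matrix Literature.MathematicalPhysics.QuantumFieldTheory
  Literature.MathematicalPhysics.QuantumLattice
open Literature.Probability.LatticeModels (TorusSite)

namespace Summit.QuantumFields.QCD.Cruxes.StableActionBridge.Sketch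

/-- In `SU(3)` the conjugate-transpose entry is the entry of the group inverse:
`star (W_{dc}) = (W⁻¹)_{cd}` (`W⁻¹ = Wᴴ`, Mathlib's `Matrix.star_eq_inv`, definitional). [folklore] -/
private theorem star_apply_eq_inv_apply (W : Matrix.specialUnitaryGroup (Fin 3) ℂ) (c d : Fin 3) :
    star ((W : Matrix (Fin 3) (Fin 3) ℂ) d c) =
      ((W⁻¹ : Matrix.specialUnitaryGroup (Fin 3) ℂ) : Matrix (Fin 3) (Fin 3) ℂ) c d := rfl

/-- **Dictionary: kinetic remainder `A − B̂ = ½∑ⱼ (W_j − W_jᴴ) ⊗ γ_{j+1}`.**  For a four-torus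
`SU(3)` gauge field `U`, one flavour of bare mass `m` and a time `t`: with `A` the explicit
slice-`t` block of the `r = 1` Wilson–Dirac operator on `TorusSite 3 L × Fin 3 × Fin 4`
(diagonal `m + 4`, forward hop `−½(1 − γ_{j+1}) ρ(U)`, backward hop `−½(1 + γ_{j+1}) ρ(U)⁻¹`,
`ρ` the fundamental representation) and `B̂ = B ⊗ 1₄` the spin-diagonal lift of its spin-blind
block `B = δ(m + 4) − ½∑ⱼ(ρ(U) δ_{y,x+ĵ} + ρ(U)⁻¹ δ_{x,y+ĵ})`, the entry `(p, q)` of `A − B̂` is the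
entry `((0,p),(0,q))` of Smit's `½ ∑ⱼ sliceKron (colourHop V j − (colourHop V j)ᴴ) γ_{j+1}` for the
slice configuration `V : e ↦ U((t, e.1), e.2.succ)` (the backward hop uses `U⁻¹ = Uᴴ` in `SU(3)`).
[cite: Smit2023, §6.5 (6.74)–(6.75)] -/
theorem timeSlice_kinetic_dictionary : ∀ (L : ℕ) [NeZero L] (U : GaugeConfig 4 L (Matrix.specialUnitaryGroup (Fin 3) ℂ)) (m : ℝ) (t : ZMod L) (p q : TorusSite 3 L × Fin 3 × Fin 4), let A : Matrix (TorusSite 3 L × Fin 3 × Fin 4) (TorusSite 3 L × Fin 3 × Fin 4) ℂ := Matrix.of fun a b => (if a = b then ((m + 4 * 1 : ℝ) : ℂ) else 0) - (1 / 2 : ℂ) * ∑ j : Fin 3, ((if b.1 = Literature.MathematicalPhysics.QuantumFieldTheory.Site.shift a.1 j then (((1 : ℝ) : ℂ) • (1 : Matrix (Fin 4) (Fin 4) ℂ) - euclideanGamma j.succ) a.2.2 b.2.2 * fundamentalRep (Fin 3) (U ((Fin.cons t a.1 : TorusSite 4 L), j.succ)) a.2.1 b.2.1 else 0) + (if a.1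 = Literature.MathematicalPhysics.QuantumFieldTheory.Site.shift b.1 j then (((1 : ℝ) : ℂ) • (1 : Matrix (Fin 4) (Fin 4) ℂ) + euclideanGamma j.succ) a.2.2 b.2.2 * fundamentalRep (Fin 3) (U ((Fin.cons t b.1 : TorusSite 4 L), j.succ))⁻¹ a.2.1 b.2.1 else 0)); let B : Matrix (TorusSite 3 L × Fin 3) (TorusSite 3 L × Fin 3) ℂ := Matrix.of fun a b => (if a = b then ((m + 4 : ℝ) : ℂ) else 0) - (1 / 2 : ℂ) * ∑ j : Fin 3, ((if b.1 = Literature.MathematicalPhysics.QuantumFieldTheory.Site.shift a.1 j then fundamentalRep (Fin 3) (U ((Fin.cons t a.1 : TorusSite 4 L), j.succ)) a.2 b.2 else 0) + (if a.1 = Literature.MathematicalPhysics.QuantumFieldTheory.Site.shift b.1 j then fundamentalRep (Fin 3) (U ((Fin.cons t b.1 : TorusSite 4 L), j.succ))⁻¹ a.2 b.2 else 0)); let Bh : Matrix (TorusSite 3 L × Fin 3 × Fin 4) (TorusSite 3 L × Fin 3 × Fin 4) ℂ := Matrix.of fun a b => if a.2.2 = b.2.2 then B (a.1, a.2.1) (b.1,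 b.2.1) else 0; (A - Bh) p q = ((1 / 2 : ℂ) • ∑ j : Fin 3, sliceKron (Nf := 1) (colourHop (fun e : Edge 3 L => U ((Fin.cons t e.1 : TorusSite 4 L), e.2.succ)) j - (colourHop (fun e : Edge 3 L => U ((Fin.cons t e.1 : TorusSite 4 L), e.2.succ)) j)ᴴ) (euclideanGamma j.succ)) (0, p) (0, q) := by
  rintro L _ U m t ⟨x, c, s⟩ ⟨y, d, s'⟩
  by_cases hs : s = s'
  · -- spin-diagonal entry `α = β`: the mass terms and the `1 ⊗`-parts of the hops cancel against `B̂`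
    subst hs
    simp only [Matrix.sub_apply, Matrix.add_apply, Matrix.of_apply, Matrix.smul_apply,
      Matrix.sum_apply, sliceKron, colourHop, Matrix.conjTranspose_apply, smul_eq_mul, true_and,
      and_true, fundamentalRep_apply, Complex.ofReal_one, one_mul, Matrix.one_apply_eq, mul_one,
      Prod.mk.injEq, if_true]
    rw [sub_sub_sub_cancel_left, ← mul_sub, ← Finset.sum_sub_distrib]
    congr 1
    refine Finset.sum_congr rfl fun j _ => ?_
    -- per direction `j`: split on the two shift deltas; backward hop `star (U_{dc}) = (U⁻¹)_{cd}`
    split_ifs <;> simp only [star_apply_eq_inv_apply, star_zero] <;> ring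
  · -- off-diagonal spin entry `α ≠ β`: `B̂` and the diagonal of `A` vanish, only `γ`-parts remain
    simp only [Matrix.sub_apply, Matrix.add_apply, Matrix.of_apply, Matrix.smul_apply,
      Matrix.sum_apply, sliceKron, colourHop, Matrix.conjTranspose_apply, smul_eq_mul, true_and,
      fundamentalRep_apply, Complex.ofReal_one, one_mul, Matrix.one_apply, hs, if_false, and_false,
      Prod.mk.injEq, zero_sub, sub_zero, zero_add]
    rw [← mul_neg, ← Finset.sum_neg_distrib]
    congr 1
    refine Finset.sum_congr rfl fun j _ => ?_
    split_ifs <;> simp only [star_apply_eq_inv_apply, star_zero] <;> ring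

end Summit.QuantumFields.QCD.Cruxes.StableActionBridge.Sketch

end
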